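import Summits.NavierStokesRegularity.NavierStokesRegularity.Theorems.ExtremiserTransienceNearExtremalTransienceExtremiserLiouvillePlateau
import Summits.NavierStokesRegularity.NavierStokesRegularity.Theorems.ExtremiserTransiencePlateauSliceRigidity
import HarnessLib

/-!
# Crux `ExtremiserTransience.NearExtremalTransience` (stmt-NavierStokesRegularity-21883) — LINE B `extremiser_liouville`,
# rev-1.4 RESHAPE NOTE «K1 bypass»: a Type-I-decaying extremal ancient object is excluded by TREE THEOREMS

Author: ideator seat `ns-idea-10` (generation 6, lens «rescuer»).  SORRY-FREE support file; it touches no registered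
skeleton (LINE B's skeleton of record `Lines/extremiser_liouville.lean` b2eff6c6ff27 stands) and proves no summit, crux
or rung of the ladder.  Companion note: `Lines/extremiser_liouville_k1bypass.md`.

THE OBSERVATION.  LINE B kills the compactness limit of a violating sequence ("extremal ancient object": a KNSS
blow-up limit `W`, Oseen-mild, whose slices on a positive-measure set of times are EXTENDED EXTREMISERS of the sharp
stretching inequality) through K1a (slices analytic) + K1b (no analytic extended extremiser — open; a prover has
reduced it to «no analytic CONSTANT-SPEED extended extremiser», p639524).  If the object additionally carries the
Type-I decay clause `√(−t)‖W t x‖ ≤ K` — which every zoom of a Type-I flow delivers for free (two-sided scale lock,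
p625112; it is already a conjunct of `NoQuantumSheet` 27695 and of `PlateauSliceTransfer` 27822) — then K1a and K1b are
NOT NEEDED: for a.e. extremal slice `W t₀`,
  * `extendedSharp` (p640354 chain) gives `|S| ≤ κ⋆M√Z√P`, so the slice clause `κ⋆M√Z√P ≤ |S|` is EQUALITY;
  * `ext_interior_contact_nonempty_of_extremal` (p639524, prover ns-el-k1b g2) gives `interior {‖W t₀‖ = M} ≠ ∅`,
    hence `0 < volume {‖W t₀‖ = M}` (open sets have positive Lebesgue measure);
  * `plateauSliceRigidity` (item 27823, PROVED, prover of LINE g5-α) says exactly that no continuous Oseen-mild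
    Type-I-decaying ancient field has a slice with sup `m > 0` attained on a positive-measure set.
Hence `extremalAncientTypeI_false` below (kernel-checked, no `sorry`).

CONSEQUENCES (all proved below, hypotheses BY NAME of route decls or of their decay-augmented variants defined here):
  * `noExtremalAncientTypeI` — item 26569 `NoExtremalAncient` with the decay clause added to its object HOLDS outright;
  * `nearExtremalTransiencePerFlow_of_tangentTypeI : TangentExtremalExtractionTypeI → NearExtremalTransiencePerFlow` —
    26568 with the (free) decay clause in its conclusion ALONE implies the live crux 26567;
  * `nearExtremalTransiencePerFlow_of_sheetDichotomy : NoQuantumSheet → SheetOrTangentTypeI → NearExtremalTransiencePerFlow`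
    — LINE g5-β's split (27695, 27696) re-composed through the bypass: with decay threaded into the tangent branch of
    27696, the two children give 26567 with NO appeal to 26569 / K1a / K1b.
What is NOT claimed: 26569 as typed (no decay clause) is not proved here — for NON-decaying bounded ancient fields the
constant-speed residue of K1b remains the obstruction; nothing here proves NS regularity. [folklore]
-/

noncomputable section

open Set Filter Topology MeasureTheory Metric Function
open scoped ENNReal NNReal Topology InnerProductSpace RealInnerProductSpace ContDiff
open Literature.Analysis.FluidPDE Literature.Analysis

namespace Summit.NavierStokesRegularity.NavierStokesRegularity.Cruxes.NearExtremalTransience.ExtremiserLiouville.K1Bypass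

set_option linter.dupNamespace false
set_option linter.unusedVariables false
set_option linter.style.longLine false
set_option linter.style.setOption false

open Summit.NavierStokesRegularity.NavierStokesRegularity.Theses.ExtremiserTransience
open Summit.NavierStokesRegularity.NavierStokesRegularity.Theorems.ExtremiserLiouville

/-- The **Type-I extremal ancient object**: LINE B's compactness limit (= the `∃`-body of item 26569 `NoExtremalAncient`)
WITH the Type-I decay clause `√(−t)‖W t x‖ ≤ K` (free from the zoom of a Type-I flow; verbatim the clause of 27695/27822). -/
def IsExtremalAncientTypeI (W : ℝ → EuclideanSpace ℝ (Fin 3) → EuclideanSpace ℝ (Fin 3)) (K a b : ℝ) : Prop :=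
  (Literature.Analysis.FluidPDE.IsKNSSBlowupLimit W ∧ (∀ s t : ℝ, s < t → t < 0 → ∀ x, W t x = Literature.Analysis.FluidPDE.heatFlow (W s) (t - s) x - Literature.Analysis.FluidPDE.oseenDuhamel 1 s W W t x)) ∧ (∀ t : ℝ, t < 0 → ∀ x, Real.sqrt (-t) * ‖W t x‖ ≤ K) ∧ a < b ∧ b ≤ 0 ∧ ∀ᵐ t : ℝ, t ∈ Set.Ioo a b → (ContDiff ℝ (⊤ : ℕ∞) (W t) ∧ Literature.Analysis.FluidPDE.VectorCalculus.IsDivFree (W t) ∧ (∃ B : ℝ, ∀ x, ‖fderiv ℝ (W t) x‖ ≤ B) ∧ (∫⁻ x, ‖iteratedFDeriv ℝ 1 (W t) x‖ₑ ^ 2 < ⊤) ∧ (∫⁻ x, ‖iteratedFDeriv ℝ 2 (W t) x‖ₑ ^ 2 < ⊤) ∧ ∃ M : ℝ, (∀ x, ‖(W t) x‖ ≤ M) ∧ 0 < M * Real.sqrt (∫ x, ‖Literature.Analysis.FluidPDE.curl (W t) x‖ ^ 2) * Real.sqrt (∫ x, Literature.Analysis.FluidPDE.frobeniusNormSq (fderiv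 ℝ (Literature.Analysis.FluidPDE.curl (W t)) x)) ∧ (sInf {κ : ℝ | (∀ (v : EuclideanSpace ℝ (Fin 3) → EuclideanSpace ℝ (Fin 3)) (M B : ℝ), ContDiff ℝ (⊤ : ℕ∞) v → Literature.Analysis.FluidPDE.VectorCalculus.IsDivFree v → (∀ x, ‖v x‖ ≤ M) → (∀ x, ‖fderiv ℝ v x‖ ≤ B) → (∫⁻ x, ‖iteratedFDeriv ℝ 0 v x‖ₑ ^ 2 < ⊤) → (∫⁻ x, ‖iteratedFDeriv ℝ 1 v x‖ₑ ^ 2 < ⊤) → (∫⁻ x, ‖iteratedFDeriv ℝ 2 v x‖ₑ ^ 2 < ⊤) → |∫ x, ⟪Literature.Analysis.FluidPDE.curl v x, fderiv ℝ v x (Literature.Analysis.FluidPDE.curl v x)⟫_ℝ| ≤ κ * M * Real.sqrt (∫ x, ‖Literature.Analysis.FluidPDE.curl v x‖ ^ 2) * Real.sqrt (∫ x, Literature.Analysis.FluidPDE.frobeniusNormSq (fderiv ℝ (Literature.Analysis.FluidPDE.curl v) x)))}) * M * Real.sqrt (∫ x, ‖Literature.Analysis.FluidPDE.curl (W t) x‖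 ^ 2) * Real.sqrt (∫ x, Literature.Analysis.FluidPDE.frobeniusNormSq (fderiv ℝ (Literature.Analysis.FluidPDE.curl (W t)) x)) ≤ |∫ x, ⟪Literature.Analysis.FluidPDE.curl (W t) x, fderiv ℝ (W t) x (Literature.Analysis.FluidPDE.curl (W t) x)⟫_ℝ|)

/-- a.e. on a nondegenerate interval ⇒ somewhere on it. -/
theorem exists_of_ae_Ioo {P : ℝ → Prop} {a b : ℝ} (hab : a < b) (h : ∀ᵐ t : ℝ, t ∈ Set.Ioo a b → P t) :
    ∃ t ∈ Set.Ioo a b, P t := by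
  by_contra hne
  push Not at hne
  have h0 : ∀ᵐ t : ℝ, t ∉ Set.Ioo a b := h.mono fun t ht hmem => hne t hmem (ht hmem)
  have hz : volume (Set.Ioo a b) = 0 := measure_eq_zero_iff_ae_notMem.mpr h0
  rw [Real.volume_Ioo, ENNReal.ofReal_eq_zero] at hz
  linarith

/-- **K1 bypass.**  No Type-I extremal ancient object exists — by `extendedSharp` + `ext_interior_contact_nonempty_of_extremal`
(p639524) + `plateauSliceRigidity` (27823).  [folklore] -/
theorem extremalAncientTypeI_false :
    ¬ ∃ (W : ℝ → EuclideanSpace ℝ (Fin 3) → EuclideanSpace ℝ (Fin 3)) (K a b : ℝ), IsExtremalAncientTypeI W K a b := by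
  rintro ⟨W, K, a, b, ⟨hknss, hmild⟩, hdec, hab, hb0, hae⟩
  obtain ⟨t₀, ht₀, hcd, hdiv, ⟨B, hB⟩, h1, h2, M, hM, hpos, hge⟩ := exists_of_ae_Ioo hab hae
  have ht₀neg : t₀ < 0 := lt_of_lt_of_le ht₀.2 hb0
  -- equality in the sharp inequality (extended class)
  have hle := extendedSharp (W t₀) M B hcd hdiv hM hB h1 h2
  have hatt := le_antisymm hle hge
  -- the contact set has nonempty interior, hence positive volume
  have hint := ext_interior_contact_nonempty_of_extremal hcd hdiv hM hB h1 h2 hpos hatt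
  have hvol : 0 < volume {y | ‖W t₀ y‖ = M} :=
    lt_of_lt_of_le (isOpen_interior.measure_pos volume hint) (measure_mono interior_subset)
  -- M > 0 from 0 < M √Z √P
  have hMpos : 0 < M := by
    by_contra hM0
    push Not at hM0
    have hzp : 0 ≤ Real.sqrt (∫ x, ‖curl (W t₀) x‖ ^ 2) * Real.sqrt (∫ x, frobeniusNormSq (fderiv ℝ (curl (W t₀)) x)) :=
      mul_nonneg (Real.sqrt_nonneg _) (Real.sqrt_nonneg _)
    have := mul_le_mul_of_nonneg_right hM0 hzp
    rw [mul_assoc] at hpos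
    linarith
  -- continuity of the space-time field on t < 0 from the KNSS class
  have hcont : ContinuousOn (Function.uncurry W) (Set.Iio 0 ×ˢ Set.univ) := hknss.smooth.continuousOn
  exact plateauSliceRigidity ⟨W, K, t₀, M, hcont, hmild, hdec, ht₀neg, hMpos, hM, hvol⟩

/-- Item 26569 `NoExtremalAncient` WITH the Type-I decay clause added to its object (decl-for-decl the same text otherwise). -/
def NoExtremalAncientTypeI : Prop :=
  ¬ ∃ (W : ℝ → EuclideanSpace ℝ (Fin 3) → EuclideanSpace ℝ (Fin 3)) (K a b : ℝ), (Literature.Analysis.FluidPDE.IsKNSSBlowupLimit W ∧ (∀ s t : ℝ, s < t → t < 0 → ∀ x, W t x = Literature.Analysis.FluidPDE.heatFlow (W s) (t - s) x - Literature.Analysis.FluidPDE.oseenDuhamel 1 s W W t x)) ∧ (∀ t : ℝ, t < 0 → ∀ x, Real.sqrt (-t) * ‖W t x‖ ≤ K) ∧ a < b ∧ b ≤ 0 ∧ ∀ᵐ t : ℝ, t ∈ Set.Ioo a b → (ContDiff ℝ (⊤ : ℕ∞) (W t) ∧ Literature.Analysis.FluidPDE.VectorCalculus.IsDivFree (W t)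 ∧ (∃ B : ℝ, ∀ x, ‖fderiv ℝ (W t) x‖ ≤ B) ∧ (∫⁻ x, ‖iteratedFDeriv ℝ 1 (W t) x‖ₑ ^ 2 < ⊤) ∧ (∫⁻ x, ‖iteratedFDeriv ℝ 2 (W t) x‖ₑ ^ 2 < ⊤) ∧ ∃ M : ℝ, (∀ x, ‖(W t) x‖ ≤ M) ∧ 0 < M * Real.sqrt (∫ x, ‖Literature.Analysis.FluidPDE.curl (W t) x‖ ^ 2) * Real.sqrt (∫ x, Literature.Analysis.FluidPDE.frobeniusNormSq (fderiv ℝ (Literature.Analysis.FluidPDE.curl (W t)) x)) ∧ (sInf {κ : ℝ | (∀ (v : EuclideanSpace ℝ (Fin 3) → EuclideanSpace ℝ (Fin 3)) (M B : ℝ), ContDiff ℝ (⊤ : ℕ∞) v → Literature.Analysis.FluidPDE.VectorCalculus.IsDivFree v → (∀ x, ‖v x‖ ≤ M) → (∀ x, ‖fderiv ℝ v x‖ ≤ B) → (∫⁻ x, ‖iteratedFDeriv ℝ 0 v x‖ₑ ^ 2 < ⊤) → (∫⁻ x, ‖iteratedFDeriv ℝ 1 v x‖ₑ ^ 2 < ⊤)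 → (∫⁻ x, ‖iteratedFDeriv ℝ 2 v x‖ₑ ^ 2 < ⊤) → |∫ x, ⟪Literature.Analysis.FluidPDE.curl v x, fderiv ℝ v x (Literature.Analysis.FluidPDE.curl v x)⟫_ℝ| ≤ κ * M * Real.sqrt (∫ x, ‖Literature.Analysis.FluidPDE.curl v x‖ ^ 2) * Real.sqrt (∫ x, Literature.Analysis.FluidPDE.frobeniusNormSq (fderiv ℝ (Literature.Analysis.FluidPDE.curl v) x)))}) * M * Real.sqrt (∫ x, ‖Literature.Analysis.FluidPDE.curl (W t) x‖ ^ 2) * Real.sqrt (∫ x, Literature.Analysis.FluidPDE.frobeniusNormSq (fderiv ℝ (Literature.Analysis.FluidPDE.curl (W t)) x)) ≤ |∫ x, ⟪Literature.Analysis.FluidPDE.curl (W t) x, fderiv ℝ (W t) x (Literature.Analysis.FluidPDE.curl (W t) x)⟫_ℝ|)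

/-- **26569 ⊕ decay HOLDS.** [folklore] -/
theorem noExtremalAncientTypeI : NoExtremalAncientTypeI := extremalAncientTypeI_false

/-- Item 26568 `TangentExtremalExtraction` WITH the Type-I decay clause added to its conclusion (the zoom delivers it). -/
def TangentExtremalExtractionTypeI : Prop :=
  ∀ (C ν T : ℝ), 0 < C → 0 < ν → 0 < T → ∀ (u : ℝ → EuclideanSpace ℝ (Fin 3) → EuclideanSpace ℝ (Fin 3)) (p : ℝ → EuclideanSpace ℝ (Fin 3) → ℝ), Literature.Analysis.FluidPDE.IsClassicalNSSolutionOn (Set.Ico 0 T) ν 0 u p → Literature.Analysis.FluidPDE.IsLerayHopfOn T ν 0 (u 0) u → Literature.Analysis.FluidPDE.HasRapidSpatialDecay (u 0) → (∀ᶠ t in 𝓝[<] T, ∀ x, Real.sqrt (T - t) * ‖u t x‖ ≤ C * Real.sqrt ν) → ¬ Literature.Analysis.FluidPDE.HasSmoothExtensionPast ν 0 u T → ¬ (∃ θ : ℝ, 0 ≤ θ ∧ θ < 1 ∧ ∀ κ : ℝ, (∀ (v : EuclideanSpace ℝ (Fin 3) → EuclideanSpace ℝ (Fin 3)) (M B :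 ℝ), ContDiff ℝ (⊤ : ℕ∞) v → Literature.Analysis.FluidPDE.VectorCalculus.IsDivFree v → (∀ x, ‖v x‖ ≤ M) → (∀ x, ‖fderiv ℝ v x‖ ≤ B) → (∫⁻ x, ‖iteratedFDeriv ℝ 0 v x‖ₑ ^ 2 < ⊤) → (∫⁻ x, ‖iteratedFDeriv ℝ 1 v x‖ₑ ^ 2 < ⊤) → (∫⁻ x, ‖iteratedFDeriv ℝ 2 v x‖ₑ ^ 2 < ⊤) → |∫ x, ⟪Literature.Analysis.FluidPDE.curl v x, fderiv ℝ v x (Literature.Analysis.FluidPDE.curl v x)⟫_ℝ| ≤ κ * M * Real.sqrt (∫ x, ‖Literature.Analysis.FluidPDE.curl v x‖ ^ 2) * Real.sqrt (∫ x, Literature.Analysis.FluidPDE.frobeniusNormSq (fderiv ℝ (Literature.Analysis.FluidPDE.curl v) x))) → ∃ t₁ ∈ Set.Ico 0 T, ∃ (k : ℝ → ℝ) (B : ℝ), Measurable k ∧ (∀ τ, 0 ≤ k τ ∧ k τ ≤ 1) ∧ (∀ t ∈ Set.Ico t₁ T, ∀ M : ℝ, (∀ x, ‖u t x‖ ≤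 M) → |∫ x, ⟪Literature.Analysis.FluidPDE.curl (u t) x, fderiv ℝ (u t) x (Literature.Analysis.FluidPDE.curl (u t) x)⟫_ℝ| ≤ k t * M * Real.sqrt (∫ x, ‖Literature.Analysis.FluidPDE.curl (u t) x‖ ^ 2) * Real.sqrt (∫ x, Literature.Analysis.FluidPDE.frobeniusNormSq (fderiv ℝ (Literature.Analysis.FluidPDE.curl (u t)) x))) ∧ (∀ t ∈ Set.Ico t₁ T, ∫ τ in t₁..t, k τ ^ 2 / (T - τ) ≤ (θ * κ) ^ 2 * Real.log ((T - t₁) / (T - t)) + B)) → ∃ (W : ℝ → EuclideanSpace ℝ (Fin 3) → EuclideanSpace ℝ (Fin 3)) (K a b : ℝ), (Literature.Analysis.FluidPDE.IsKNSSBlowupLimit W ∧ (∀ s t : ℝ, s < t → t < 0 → ∀ x, W t x = Literature.Analysis.FluidPDE.heatFlow (W s) (t - s) x - Literature.Analysis.FluidPDE.oseenDuhamel 1 s W W t x)) ∧ (∀ t : ℝ, t < 0 → ∀ x, Real.sqrt (-t) * ‖W t x‖ ≤ K) ∧ a < b ∧ b ≤ 0 ∧ ∀ᵐ t : ℝ,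 t ∈ Set.Ioo a b → (ContDiff ℝ (⊤ : ℕ∞) (W t) ∧ Literature.Analysis.FluidPDE.VectorCalculus.IsDivFree (W t) ∧ (∃ B : ℝ, ∀ x, ‖fderiv ℝ (W t) x‖ ≤ B) ∧ (∫⁻ x, ‖iteratedFDeriv ℝ 1 (W t) x‖ₑ ^ 2 < ⊤) ∧ (∫⁻ x, ‖iteratedFDeriv ℝ 2 (W t) x‖ₑ ^ 2 < ⊤) ∧ ∃ M : ℝ, (∀ x, ‖(W t) x‖ ≤ M) ∧ 0 < M * Real.sqrt (∫ x, ‖Literature.Analysis.FluidPDE.curl (W t) x‖ ^ 2) * Real.sqrt (∫ x, Literature.Analysis.FluidPDE.frobeniusNormSq (fderiv ℝ (Literature.Analysis.FluidPDE.curl (W t)) x)) ∧ (sInf {κ : ℝ | (∀ (v : EuclideanSpace ℝ (Fin 3) → EuclideanSpace ℝ (Fin 3)) (M B : ℝ), ContDiff ℝ (⊤ : ℕ∞) v → Literature.Analysis.FluidPDE.VectorCalculus.IsDivFree v → (∀ x, ‖v x‖ ≤ M) → (∀ x, ‖fderiv ℝ v x‖ ≤ B) → (∫⁻ x, ‖iteratedFDeriv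 ℝ 0 v x‖ₑ ^ 2 < ⊤) → (∫⁻ x, ‖iteratedFDeriv ℝ 1 v x‖ₑ ^ 2 < ⊤) → (∫⁻ x, ‖iteratedFDeriv ℝ 2 v x‖ₑ ^ 2 < ⊤) → |∫ x, ⟪Literature.Analysis.FluidPDE.curl v x, fderiv ℝ v x (Literature.Analysis.FluidPDE.curl v x)⟫_ℝ| ≤ κ * M * Real.sqrt (∫ x, ‖Literature.Analysis.FluidPDE.curl v x‖ ^ 2) * Real.sqrt (∫ x, Literature.Analysis.FluidPDE.frobeniusNormSq (fderiv ℝ (Literature.Analysis.FluidPDE.curl v) x)))}) * M * Real.sqrt (∫ x, ‖Literature.Analysis.FluidPDE.curl (W t) x‖ ^ 2) * Real.sqrt (∫ x, Literature.Analysis.FluidPDE.frobeniusNormSq (fderiv ℝ (Literature.Analysis.FluidPDE.curl (W t)) x)) ≤ |∫ x, ⟪Literature.Analysis.FluidPDE.curl (W t) x, fderiv ℝ (W t) x (Literature.Analysis.FluidPDE.curl (W t) x)⟫_ℝ|)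

/-- **26568 ⊕ decay ALONE gives the live crux 26567** (no 26569, no K1a/K1b). [folklore] -/
theorem nearExtremalTransiencePerFlow_of_tangentTypeI :
    TangentExtremalExtractionTypeI → NearExtremalTransiencePerFlow := by
  intro hext C ν T hC hν hT u p hns hLH hdec hTI hne
  by_contra hno
  obtain ⟨W, K, a, b, hobj⟩ := hext C ν T hC hν hT u p hns hLH hdec hTI hne hno
  exact extremalAncientTypeI_false ⟨W, K, a, b, hobj⟩

/-- Item 27696 `SheetOrTangent` WITH the Type-I decay clause threaded into its tangent branch. -/
def SheetOrTangentTypeI : Prop :=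
  ∀ (C ν T : ℝ), 0 < C → 0 < ν → 0 < T → ∀ (u : ℝ → EuclideanSpace ℝ (Fin 3) → EuclideanSpace ℝ (Fin 3)) (p : ℝ → EuclideanSpace ℝ (Fin 3) → ℝ), Literature.Analysis.FluidPDE.IsClassicalNSSolutionOn (Set.Ico 0 T) ν 0 u p → Literature.Analysis.FluidPDE.IsLerayHopfOn T ν 0 (u 0) u → Literature.Analysis.FluidPDE.HasRapidSpatialDecay (u 0) → (∀ᶠ t in 𝓝[<] T, ∀ x, Real.sqrt (T - t) * ‖u t x‖ ≤ C * Real.sqrt ν) → ¬ Literature.Analysis.FluidPDE.HasSmoothExtensionPast ν 0 u T → ¬ (∃ θ : ℝ, 0 ≤ θ ∧ θ < 1 ∧ ∀ κ : ℝ, (∀ (v : EuclideanSpace ℝ (Fin 3) → EuclideanSpace ℝ (Fin 3)) (M B : ℝ), ContDiff ℝ (⊤ : ℕ∞) v → Literature.Analysis.FluidPDE.VectorCalculus.IsDivFree v → (∀ x, ‖v x‖ ≤ M) → (∀ x, ‖fderiv ℝ v x‖ ≤ B) → (∫⁻ x, ‖iteratedFDeriv ℝ 0 v x‖ₑ ^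 2 < ⊤) → (∫⁻ x, ‖iteratedFDeriv ℝ 1 v x‖ₑ ^ 2 < ⊤) → (∫⁻ x, ‖iteratedFDeriv ℝ 2 v x‖ₑ ^ 2 < ⊤) → |∫ x, ⟪Literature.Analysis.FluidPDE.curl v x, fderiv ℝ v x (Literature.Analysis.FluidPDE.curl v x)⟫_ℝ| ≤ κ * M * Real.sqrt (∫ x, ‖Literature.Analysis.FluidPDE.curl v x‖ ^ 2) * Real.sqrt (∫ x, Literature.Analysis.FluidPDE.frobeniusNormSq (fderiv ℝ (Literature.Analysis.FluidPDE.curl v) x))) → ∃ t₁ ∈ Set.Ico 0 T, ∃ (k : ℝ → ℝ) (B : ℝ), Measurable k ∧ (∀ τ, 0 ≤ k τ ∧ k τ ≤ 1) ∧ (∀ t ∈ Set.Ico t₁ T, ∀ M : ℝ, (∀ x, ‖u t x‖ ≤ M) → |∫ x, ⟪Literature.Analysis.FluidPDE.curl (u t) x, fderiv ℝ (u t) x (Literature.Analysis.FluidPDE.curl (u t) x)⟫_ℝ| ≤ k t * M * Real.sqrt (∫ x, ‖Literature.Analysis.FluidPDE.curl (u t) x‖ ^ 2) * Real.sqrt (∫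 x, Literature.Analysis.FluidPDE.frobeniusNormSq (fderiv ℝ (Literature.Analysis.FluidPDE.curl (u t)) x))) ∧ (∀ t ∈ Set.Ico t₁ T, ∫ τ in t₁..t, k τ ^ 2 / (T - τ) ≤ (θ * κ) ^ 2 * Real.log ((T - t₁) / (T - t)) + B)) → (∃ (W : ℝ → EuclideanSpace ℝ (Fin 3) → EuclideanSpace ℝ (Fin 3)) (K a b : ℝ), (Literature.Analysis.FluidPDE.IsKNSSBlowupLimit W ∧ (∀ s t : ℝ, s < t → t < 0 → ∀ x, W t x = Literature.Analysis.FluidPDE.heatFlow (W s) (t - s) x - Literature.Analysis.FluidPDE.oseenDuhamel 1 s W W t x)) ∧ (∀ t : ℝ, t < 0 → ∀ x, Real.sqrt (-t) * ‖W t x‖ ≤ K) ∧ a < b ∧ b ≤ 0 ∧ ∀ᵐ t : ℝ, t ∈ Set.Ioo a b → (ContDiff ℝ (⊤ : ℕ∞) (W t) ∧ Literature.Analysis.FluidPDE.VectorCalculus.IsDivFree (W t) ∧ (∃ B : ℝ, ∀ x, ‖fderiv ℝ (W t) x‖ ≤ B) ∧ (∫⁻ x, ‖iteratedFDeriv ℝ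 1 (W t) x‖ₑ ^ 2 < ⊤) ∧ (∫⁻ x, ‖iteratedFDeriv ℝ 2 (W t) x‖ₑ ^ 2 < ⊤) ∧ ∃ M : ℝ, (∀ x, ‖(W t) x‖ ≤ M) ∧ 0 < M * Real.sqrt (∫ x, ‖Literature.Analysis.FluidPDE.curl (W t) x‖ ^ 2) * Real.sqrt (∫ x, Literature.Analysis.FluidPDE.frobeniusNormSq (fderiv ℝ (Literature.Analysis.FluidPDE.curl (W t)) x)) ∧ (sInf {κ : ℝ | (∀ (v : EuclideanSpace ℝ (Fin 3) → EuclideanSpace ℝ (Fin 3)) (M B : ℝ), ContDiff ℝ (⊤ : ℕ∞) v → Literature.Analysis.FluidPDE.VectorCalculus.IsDivFree v → (∀ x, ‖v x‖ ≤ M) → (∀ x, ‖fderiv ℝ v x‖ ≤ B) → (∫⁻ x, ‖iteratedFDeriv ℝ 0 v x‖ₑ ^ 2 < ⊤) → (∫⁻ x, ‖iteratedFDeriv ℝ 1 v x‖ₑ ^ 2 < ⊤) → (∫⁻ x, ‖iteratedFDeriv ℝ 2 v x‖ₑ ^ 2 < ⊤) → |∫ x, ⟪Literature.Analysis.FluidPDE.curl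 v x, fderiv ℝ v x (Literature.Analysis.FluidPDE.curl v x)⟫_ℝ| ≤ κ * M * Real.sqrt (∫ x, ‖Literature.Analysis.FluidPDE.curl v x‖ ^ 2) * Real.sqrt (∫ x, Literature.Analysis.FluidPDE.frobeniusNormSq (fderiv ℝ (Literature.Analysis.FluidPDE.curl v) x)))}) * M * Real.sqrt (∫ x, ‖Literature.Analysis.FluidPDE.curl (W t) x‖ ^ 2) * Real.sqrt (∫ x, Literature.Analysis.FluidPDE.frobeniusNormSq (fderiv ℝ (Literature.Analysis.FluidPDE.curl (W t)) x)) ≤ |∫ x, ⟪Literature.Analysis.FluidPDE.curl (W t) x, fderiv ℝ (W t) x (Literature.Analysis.FluidPDE.curl (W t) x)⟫_ℝ|)) ∨ (¬ NoQuantumSheet)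

/-- **LINE g5-β re-composed through the bypass**: `NoQuantumSheet` (27695, verbatim) and `SheetOrTangentTypeI` give
`TangentExtremalExtractionTypeI`, hence 26567 — BY NAME. [folklore] -/
theorem tangentTypeI_of_sheetDichotomy :
    NoQuantumSheet → SheetOrTangentTypeI → TangentExtremalExtractionTypeI := by
  intro hsheet hsot C ν T hC hν hT u p hns hLH hdec hTI hne hno
  rcases hsot C ν T hC hν hT u p hns hLH hdec hTI hne hno with h | h
  · exact h
  · exact absurd hsheet h

theorem nearExtremalTransiencePerFlow_of_sheetDichotomy :
    NoQuantumSheet → SheetOrTangentTypeI → NearExtremalTransiencePerFlow :=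
  fun hsheet hsot => nearExtremalTransiencePerFlow_of_tangentTypeI (tangentTypeI_of_sheetDichotomy hsheet hsot)

end Summit.NavierStokesRegularity.NavierStokesRegularity.Cruxes.NearExtremalTransience.ExtremiserLiouville.K1Bypass

end
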